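import Summits.QuantumFields.YangMills.Theorems.BalabanUVNodesPortU8TwoVolumeRowA

/-!
# PORT PT-B (U8), g3 file 13 — THE SANDWICH FOR 27931 v11-G₄'s GLOBAL (R4ᴰ), PART B: the stencil of an off-wrap bond lifts bond by bond; the `𝐔`∕`𝐉`-block identities of the
# cut two-volume difference vector (`cutTo`∕`chartMatU`∕`chartMatJc` of differences and pull-backs; ★ the `𝐉`-block of the cut L-response is the linearised current of `d*d Hr`)

Cell `ym-nodeO-ideate` ∕ `ym-balaban-port`, porter `ymgap-nodeO-port-PTB-1` (gen 3), item **stmt-QuantumFields-27931** `BalabanUVNodes.PortPieceLocalityU8` (text v11-G₄ `bca3cb0d9af367ce`).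
`--supports stmt-QuantumFields-27931` (helper).  [I] = [Balaban1987RG1], [15] = [Balaban1985Variational], [B6] = [Balaban1984PropagatorsII].
HONEST FRAMING.  The sandwich estimate under the three DISPLAYED tokens of v11-G₄ (asserted by nobody); nothing of Bałaban's analysis asserted∕ported∕discharged; 27931 OPEN · SIGNED v11-G₄ ·
close HOLD until the slot word; K0⁷ OPEN; NODE O 0∕1; COUNT 8∕28 · K 1∕4 UNMOVED; finite `𝕋⁴_{L^K}` at fixed ε — NOT continuum ∕ OS ∕ Clay; **the Yang–Mills mass gap (Clay) is NOT proved.**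
-/

noncomputable section

open scoped BigOperators Matrix.Norms.L2Operator
open Complex (I)

namespace Summit.QuantumFields.YangMills.Theorems.PortU8

open Literature.MathematicalPhysics.QuantumFieldTheory.Balaban1983to89
open Literature.MathematicalPhysics.QuantumFieldTheory.Balaban1983to89.Node00
open Literature.MathematicalPhysics.QuantumFieldTheory.Balaban1983to89.T4Continuum (T4Family)
open Literature.MathematicalPhysics.QuantumFieldTheory.Balaban1983to89.B14.Eq213MaximalDomains (side)
open Summit.QuantumFields.YangMills.Theorems.K0RecordFormatNames

variable (F : T4Family)

/-! ## §1  The stencil of a bond of an off-wrap domain lifts bond by bond; chart-block identities of the two-volume difference -/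

variable {F} in
/-- The three commutation facts (`+e_ν`, `−e_ν`, `−e_ν+e_μ`) of the centred lift at the source of a bond of an off-wrap domain. [cite: Balaban1987RG1, (1.21) p.264 (bookkeeping)] -/
theorem stencil_commute_of_mem_domBonds {Mc k K : ℕ} (hMc : McGuard F Mc) (hK : recordK₀ F Mc k ≤ K) {X : (recordDomSys F Mc k K).Dom} (hX : X ∉ recordWrapCtr F Mc k K)
    {b : PBond (F.P K) 0} (hb : b ∈ domBonds F Mc k K X) :
    (∀ ν : Fin (F.P K).d, (liftSiteCtr F K 0 b.src).shift ν = liftSiteCtr F K 0 (b.src.shift ν)) ∧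
    (∀ ν : Fin (F.P K).d, (liftSiteCtr F K 0 b.src).unshift ν = liftSiteCtr F K 0 (b.src.unshift ν)) ∧
    (∀ ν μ' : Fin (F.P K).d, (liftSiteCtr F K 0 (b.src.unshift ν)).shift μ' = liftSiteCtr F K 0 ((b.src.unshift ν).shift μ')) := by
  have hv : ∀ μ, (b.src μ).val ≠ (F.P K).sitesPerDir 0 / 2 := val_ne_half_of_mem_domSites hMc hK hX hb.1
  have hv' : ∀ μ, (b.src μ).val ≠ (F.P K).sitesPerDir 0 / 2 + 1 := val_ne_half_succ_of_mem_domSites hMc hK hX hb.1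
  refine ⟨fun ν => (liftSiteCtr_shift b.src ν (hv ν)).symm, fun ν => (liftSiteCtr_unshift b.src ν (hv' ν)).symm, fun ν μ' => ?_⟩
  refine (liftSiteCtr_shift (b.src.unshift ν) μ' ?_).symm
  haveI : NeZero ((F.P K).sitesPerDir 0) := ⟨(F.P K).sitesPerDir_ne_zero 0⟩
  have hN : 2 < (F.P K).sitesPerDir 0 := by
    rw [T4Family.sitesPerDir_eq]
    have : 1 < F.L ^ (F.m + K) := Nat.one_lt_pow (by have := F.hm; omega) (by have := F.hL.2; omega)
    omega
  by_cases h : μ' = ν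
  · subst h
    rw [unshift_apply_self']
    by_cases h0 : b.src μ' = 0
    · rw [h0, zero_sub, ZMod.neg_val, if_neg (by
        intro h1
        have := congrArg ZMod.val h1
        rw [ZMod.val_one'' (by omega), ZMod.val_zero] at this
        exact one_ne_zero this), ZMod.val_one'' (by omega)]
      omega
    · have h1 : (1 : ZMod ((F.P K).sitesPerDir 0)).val ≤ (b.src μ').val := by
        rw [ZMod.val_one'' (by omega)]
        exact Nat.one_le_iff_ne_zero.2 fun h => h0 ((ZMod.val_eq_zero _).1 h)
      rw [ZMod.val_sub h1, ZMod.val_one'' (by omega)]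
      have := hv' μ'
      omega
  · rw [unshift_apply_ne' F b.src h]; exact hv μ'

/-- `cutTo` is compatible with subtraction. [cite: Balaban1987RG1, (4.35) p.290 (bookkeeping)] -/
theorem cutTo_sub {m : ℕ} (cX : Finset (Fin m)) (g g' : Fin m → ℂ) : B12FormatPlus.cutTo cX (g - g') = B12FormatPlus.cutTo cX g - B12FormatPlus.cutTo cX g' := by
  funext i; simp only [B12FormatPlus.cutTo_apply, Pi.sub_apply]; split_ifs <;> simp

variable {F} in
/-- The cut of a pulled-back coordinate vector is the pull-back of the cut (off the wrap class). [cite: Balaban1987RG1, (1.21) p.264 (bookkeeping)] -/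
theorem cutTo_comp_recordJXJ {Mc k K : ℕ} (hMc : McGuard F Mc) (hK : recordK₀ F Mc k ≤ K) {X : (recordDomSys F Mc k K).Dom} (hX : X ∉ recordWrapCtr F Mc k K)
    (f : Fin (recordChartDimJ F (K + 1)) → ℂ) :
    B12FormatPlus.cutTo (recordCXJ F Mc k K X) (fun i => f (recordJXJ F K i)) =
      fun i => B12FormatPlus.cutTo (recordCXJ F Mc k (K + 1) (recordDomEmbCtr F Mc k K X)) f (recordJXJ F K i) := by
  classical
  funext i
  obtain ⟨⟨b, t⟩, rfl⟩ := (chartEquivJ F K).surjective i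
  rw [B12FormatPlus.cutTo_apply, B12FormatPlus.cutTo_apply, recordJXJ_chartEquivJ]
  have hiff : chartEquivJ F K (b, t) ∈ recordCXJ F Mc k K X ↔ chartEquivJ F (K + 1) (liftBondCtr F K 0 b, t) ∈ recordCXJ F Mc k (K + 1) (recordDomEmbCtr F Mc k K X) := by
    rw [chartEquivJ_mem_recordCXJ_iff, chartEquivJ_mem_recordCXJ_iff, liftBondCtr_mem_domBonds_iff hMc hK X hX]
  by_cases h : chartEquivJ F K (b, t) ∈ recordCXJ F Mc k K X
  · rw [if_pos h, if_pos (hiff.1 h)]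
  · rw [if_neg h, if_neg (fun h' => h (hiff.2 h'))]

/-- The `𝐔`-block of a pulled-back coordinate vector is the `𝐔`-block at the lifted bond. [cite: Balaban1987RG1, (1.21) p.264 (bookkeeping)] -/
theorem chartMatU_comp_recordJXJ (K : ℕ) (f : Fin (recordChartDimJ F (K + 1)) → ℂ) (b : PBond (F.P K) 0) :
    chartMatU F K (fun i => f (recordJXJ F K i)) b = chartMatU F (K + 1) f (liftBondCtr F K 0 b) := by
  unfold chartMatU; simp only [recordJXJ_chartEquivJ]

/-- The `𝐉`-block of a pulled-back coordinate vector is the `𝐉`-block at the lifted bond. [cite: Balaban1987RG1, (1.21) p.264 (bookkeeping)] -/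
theorem chartMatJc_comp_recordJXJ (K : ℕ) (f : Fin (recordChartDimJ F (K + 1)) → ℂ) (b : PBond (F.P K) 0) :
    chartMatJc F K (fun i => f (recordJXJ F K i)) b = chartMatJc F (K + 1) f (liftBondCtr F K 0 b) := by
  unfold chartMatJc; simp only [recordJXJ_chartEquivJ]

/-- `chartMatU` of a difference. [cite: Balaban1987RG1, (1.9) p.261 (bookkeeping)] -/
theorem chartMatU_sub (K : ℕ) (w w' : Fin (recordChartDimJ F K) → ℂ) (b : PBond (F.P K) 0) : chartMatU F K (w - w') b = chartMatU F K w b - chartMatU F K w' b :=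
  (chartMatULM F K b).map_sub w w'

/-- `chartMatJc` of a difference. [cite: Balaban1987RG1, (1.9) p.261 (bookkeeping)] -/
theorem chartMatJc_sub (K : ℕ) (w w' : Fin (recordChartDimJ F K) → ℂ) (b : PBond (F.P K) 0) : chartMatJc F K (w - w') b = chartMatJc F K w b - chartMatJc F K w' b :=
  (chartMatJcLM F K b).map_sub w w'

/-- ★ **THE `𝐉`-BLOCK OF THE CUT L-RESPONSE IS `ξ⁻³·(−i)·π(d*d (Matrix.of ∘ Hr))`** (at the fill, standing range, TokP9reg): the rooted derivative `D = Hr + dφ` has the curls of `Hr`.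
[cite: Balaban1987RG1, (1.8) p.261, (4.4) p.281; Balaban1985Variational, (21) p.281, (182) p.307] -/
theorem chartMatJc_cutTo_recordGkL_eq_curl (a₀ ε₂₉ : ℝ) (ha₀ : 0 < a₀) (k K : ℕ) (hk : k + 1 ≤ (F.P K).m + (F.P K).K)
    (hreg : letI θ := thetaFill F a₀ ε₂₉; letI := θ.instVβ₁; letI := θ.instVβ₂; letI := θ.instιβ;
      AnalyticAt ℝ (fun B : recordW F a₀ ε₂₉ k K => fun (b : PBond (F.P K) 0) (i i' : Fin 2) => ((recordBgField F θ k K B b : SU 2) : Matrix (Fin 2) (Fin 2) ℂ) i i') 0)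
    (a : (thetaFill F a₀ ε₂₉).ιβ) (y : RespLabel F k K) {Mc : ℕ} (X : (recordDomSys F Mc k K).Dom) (b : PBond (F.P K) 0) (hb : b ∈ domBonds F Mc k K X) :
    letI H : PBond (F.P K) 0 → MatA 2 := fun b' => Matrix.of fun i i' => recordHr F (thetaFill F a₀ ε₂₉) k K a y b' i i'
    chartMatJc F K (B12FormatPlus.cutTo (recordCXJ F Mc k K X) (recordGkL F (thetaFill F a₀ ε₂₉) k K a y)) b =
      ((((F.P K).eta (k + 1) : ℂ)⁻¹) ^ 3) • ((-I) • sl2Proj (∑ ν : Fin (F.P K).d,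
        ((H ⟨b.src, b.dir⟩ + H ⟨b.src.shift b.dir, ν⟩ - H ⟨b.src.shift ν, b.dir⟩ - H ⟨b.src, ν⟩) -
          (H ⟨b.src.unshift ν, b.dir⟩ + H ⟨(b.src.unshift ν).shift b.dir, ν⟩ - H ⟨(b.src.unshift ν).shift ν, b.dir⟩ - H ⟨b.src.unshift ν, ν⟩)))) := by
  classical
  letI := (thetaFill F a₀ ε₂₉).instVβ₁; letI := (thetaFill F a₀ ε₂₉).instVβ₂; letI := (thetaFill F a₀ ε₂₉).instιβ
  have hd2 : ContDiffAt ℝ 2 (fun B : recordW F a₀ ε₂₉ k K => fun (b : PBond (F.P K) 0) (i i' : Fin 2) =>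
      ((recordBgField F (thetaFill F a₀ ε₂₉) k K B b : SU 2) : Matrix (Fin 2) (Fin 2) ℂ) i i') 0 := hreg.contDiffAt
  obtain ⟨U', hU'eq, hU'⟩ := hasFDerivAt_bgField_of_entries F (thetaFill F a₀ ε₂₉) k K (hd2.differentiableAt (by norm_num))
  have hE : DifferentiableAt ℝ (recordEmbJ F (thetaFill F a₀ ε₂₉) k K) 0 :=
    (contDiffAt_recordEmbJ_of F (thetaFill F a₀ ε₂₉) k K hk ha₀ (contDiffAt_matrix_of_entries hd2)).differentiableAt (by norm_num)
  rw [chartMatJc_cutTo_recordGkL_eq, chartMatJc_cutTo_recordGkJ F (thetaFill F a₀ ε₂₉) k K hk ha₀ U' hU' hE a y X b, if_pos hb]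
  have hUD : ∀ β : PBond (F.P K) 0, U' (Pi.single y.1 (Pi.single y.2 ((thetaFill F a₀ ε₂₉).bV a))) β = Matrix.of (recordD F (thetaFill F a₀ ε₂₉) k K a y β) := fun β => hU'eq _ β
  set φ : Site (F.P K) 0 → MatA 2 := fun x => -Matrix.of (fun i i' => landauPotC F k K (fun b' => recordD F (thetaFill F a₀ ε₂₉) k K a y b' i i') x) with hφ
  have hsplit : ∀ β : PBond (F.P K) 0, (Matrix.of (recordD F (thetaFill F a₀ ε₂₉) k K a y β) : MatA 2) =
      Matrix.of (recordHr F (thetaFill F a₀ ε₂₉) k K a y β) + (φ β.src - φ (β.src.shift β.dir)) := by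
    intro β; ext i i'
    rw [Matrix.add_apply, Matrix.sub_apply, Matrix.of_apply, Matrix.of_apply, recordD_eq_recordHr_add]
    simp only [hφ, Matrix.neg_apply, Matrix.of_apply, PBond.tgt]
    ring
  have hcurl : ∀ (x : Site (F.P K) 0) (μ ν : Fin (F.P K).d),
      U' (Pi.single y.1 (Pi.single y.2 ((thetaFill F a₀ ε₂₉).bV a))) ⟨x, μ⟩ + U' (Pi.single y.1 (Pi.single y.2 ((thetaFill F a₀ ε₂₉).bV a))) ⟨x.shift μ, ν⟩ -
        U' (Pi.single y.1 (Pi.single y.2 ((thetaFill F a₀ ε₂₉).bV a))) ⟨x.shift ν, μ⟩ - U' (Pi.single y.1 (Pi.single y.2 ((thetaFill F a₀ ε₂₉).bV a))) ⟨x, ν⟩ =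
      (Matrix.of (recordHr F (thetaFill F a₀ ε₂₉) k K a y ⟨x, μ⟩) : MatA 2) + Matrix.of (recordHr F (thetaFill F a₀ ε₂₉) k K a y ⟨x.shift μ, ν⟩) -
        Matrix.of (recordHr F (thetaFill F a₀ ε₂₉) k K a y ⟨x.shift ν, μ⟩) - Matrix.of (recordHr F (thetaFill F a₀ ε₂₉) k K a y ⟨x, ν⟩) := by
    intro x μ ν
    rw [hUD, hUD, hUD, hUD, curlF_of_exact (D := fun β => (Matrix.of (recordD F (thetaFill F a₀ ε₂₉) k K a y β) : MatA 2))
      (Hr := fun β => (Matrix.of (recordHr F (thetaFill F a₀ ε₂₉) k K a y β) : MatA 2)) hsplit x μ ν]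
  simp only [hcurl]

/-! ## §2  ★★ The per-bond four clauses for `E = Hr_{K+1}(y′) ∘ lift − Hr_K(y)` on the bonds of an off-wrap domain -/

end Summit.QuantumFields.YangMills.Theorems.PortU8

end
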